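import Literature.Barriers.ValiantsHypothesis.FullRankMultilinearFormulaLowerBound
import Literature.Barriers.ValiantsHypothesis.FullRankMultilinearCircuit
import HarnessLib

/-!
# Bridge: syntactically multilinear circuits unfold to syntactically multilinear formula trees
(Raz 2006 §2; roadmap step R6 for the multilinear-formula slice)

`FullRankMultilinearFormulaLowerBound.lean` proves Raz's theorem for formula TREES (`WExpr` with
`RazFormula.IsSyntMultilinear`).  The tree's circuit model states syntactic multilinearity on gate
lists (`Literature.Barriers.ValiantsHypothesis.IsSyntacticallyMultilinear`, Raz–Yehudayoff 2008 §2)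
and turns fan-in-two formulas (`ArithCircuit.IsFormula`) into trees by `ArithCircuit.toWExpr`
(`FormulaUnfolding.lean`: `eval_toWExpr`, `size_toWExpr_le`).  Here we show that the unfolding
preserves the syntactic variable sets and syntactic multilinearity:

* `map_varSet_gateWExprs` — the variable sets of the unfolded gate trees ARE the circuit's
  syntactic variable sets `X_v` (`gateVarSets`);
* `isSyntMultilinear_toWExpr` — a syntactically multilinear circuit unfolds to a syntactically
  multilinear tree (no fan-in or read-once hypothesis needed);
* `not_isFullRank_of_syntMultilinear_formula` — hence Raz's theorem in the circuit vocabulary: for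
  every `b`, eventually, no fan-in-two syntactically multilinear FORMULA (`IsFormula`) of size
  `≤ u^b` computes a full-rank polynomial. [Raz2006, Cor. 3.6]

## References
* [Raz2006] R. Raz, *Separation of multilinear circuit and formula size*, Theory of Computing 2
  (2006) 121–135, §2, Cor. 3.6.
-/

noncomputable section

namespace Literature.Barriers.ValiantsHypothesis.RazFormula

open MvPolynomial Finset Literature.Computability.AlgebraicComplexity
open Literature.Computability.AlgebraicComplexity.ArithCircuit
open Literature.Computability.AlgebraicComplexity.WExpr

universe u v

variable {k : Type u} {σ : Type v} [DecidableEq σ] [CommSemiring k]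

/-! ### Variable sets are preserved by the unfolding -/

/-- Operands. [cite: Raz2006, §2] -/
theorem varSet_wexprIn {es : List (WExpr k σ)} {vs : List (Finset σ)} (h : es.map varSet = vs)
    (u : Operand k σ) : varSet (u.wexprIn es) = operandVarSet vs u := by
  cases u with
  | var i => rfl
  | const c => rfl
  | gate j =>
    simp only [Operand.wexprIn, operandVarSet, ← h]
    rw [show (∅ : Finset σ) = varSet (.const (0 : k) : WExpr k σ) from rfl, List.getD_map]

/-- Weighted-sum gates. [cite: Raz2006, §2] -/
theorem varSet_sumWExpr {es : List (WExpr k σ)} {vs : List (Finset σ)} (h : es.map varSet = vs) :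
    ∀ args : List (k × Operand k σ),
      varSet (sumWExpr es args) = ((args.map Prod.snd).map (operandVarSet vs)).foldr (· ∪ ·) ∅
  | [] => rfl
  | [a] => by simp [sumWExpr, varSet_wexprIn h]
  | [a, b] => by simp [sumWExpr, varSet_wexprIn h]
  | a :: b :: c :: rest => by
    rw [sumWExpr, varSet_lin, varSet_wexprIn h, varSet_sumWExpr h (b :: c :: rest)]
    simp

/-- Product gates. [cite: Raz2006, §2] -/
theorem varSet_prodWExpr {es : List (WExpr k σ)} {vs : List (Finset σ)} (h : es.map varSet = vs) :
    ∀ args : List (Operand k σ),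
      varSet (prodWExpr es args) = (args.map (operandVarSet vs)).foldr (· ∪ ·) ∅
  | [] => rfl
  | [u] => by simp [prodWExpr, varSet_wexprIn h]
  | [u, v] => by simp [prodWExpr, varSet_wexprIn h]
  | u :: v :: w :: rest => by
    rw [prodWExpr, varSet_mul, varSet_wexprIn h, varSet_prodWExpr h (v :: w :: rest)]
    simp

/-- Gates. [cite: Raz2006, §2] -/
theorem varSet_toWExpr_gate {es : List (WExpr k σ)} {vs : List (Finset σ)} (h : es.map varSet = vs)
    (g : Gate k σ) : varSet (g.toWExpr es) = gateVarSet vs g := by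
  cases g with
  | sum args => rw [Gate.toWExpr, varSet_sumWExpr h, gateVarSet, Gate.args]
  | prod args => rw [Gate.toWExpr, varSet_prodWExpr h, gateVarSet, Gate.args]

/-- **The unfolded gate trees have the circuit's syntactic variable sets `X_v`.** [cite: Raz2006, §2] -/
theorem map_varSet_gateWExprs (gs : List (Gate k σ)) : (gateWExprs gs).map varSet = gateVarSets gs := by
  induction gs using List.reverseRecOn with
  | nil => rfl
  | append_singleton gs g ih =>
    rw [gateWExprs_append_singleton, RazYehudayoff.gateVarSets_append_singleton gs g, List.map_append,
      List.map_singleton, ih, varSet_toWExpr_gate ih]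

/-! ### Syntactic multilinearity is preserved by the unfolding -/

/-- Operands unfold to syntactically multilinear trees if the earlier gates did. [cite: Raz2006, §2] -/
theorem isSyntMultilinear_wexprIn {es : List (WExpr k σ)} (hes : ∀ e ∈ es, IsSyntMultilinear e)
    (u : Operand k σ) : IsSyntMultilinear (u.wexprIn es) := by
  cases u with
  | var i => trivial
  | const c => trivial
  | gate j =>
    simp only [Operand.wexprIn]
    rw [List.getD_eq_getElem?_getD]
    cases hj : es[j]? with
    | none => exact trivial
    | some e => exact hes e (List.mem_of_getElem? hj)

/-- Weighted sums. [cite: Raz2006, §2] -/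
theorem isSyntMultilinear_sumWExpr {es : List (WExpr k σ)} (hes : ∀ e ∈ es, IsSyntMultilinear e) :
    ∀ args : List (k × Operand k σ), IsSyntMultilinear (sumWExpr es args)
  | [] => trivial
  | [a] => by simp [sumWExpr, isSyntMultilinear_wexprIn hes]
  | [a, b] => by simp [sumWExpr, isSyntMultilinear_wexprIn hes]
  | a :: b :: c :: rest => by
    rw [sumWExpr, isSyntMultilinear_lin]
    exact ⟨isSyntMultilinear_wexprIn hes _, isSyntMultilinear_sumWExpr hes _⟩

/-- Products with pairwise disjoint operand variable sets. [cite: Raz2006, §2] -/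
theorem isSyntMultilinear_prodWExpr {es : List (WExpr k σ)} {vs : List (Finset σ)}
    (h : es.map varSet = vs) (hes : ∀ e ∈ es, IsSyntMultilinear e) :
    ∀ args : List (Operand k σ), (args.map (operandVarSet vs)).Pairwise Disjoint →
      IsSyntMultilinear (prodWExpr es args)
  | [], _ => trivial
  | [u], _ => by simpa [prodWExpr] using isSyntMultilinear_wexprIn hes u
  | [u, v], hpw => by
    simp only [prodWExpr, isSyntMultilinear_mul, varSet_wexprIn h]
    refine ⟨isSyntMultilinear_wexprIn hes u, isSyntMultilinear_wexprIn hes v, ?_⟩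
    simp only [List.map_cons, List.map_nil, List.pairwise_cons, List.mem_singleton, forall_eq,
      List.Pairwise.nil, and_true] at hpw
    exact hpw.1
  | u :: v :: w :: rest, hpw => by
    rw [prodWExpr, isSyntMultilinear_mul]
    rw [List.map_cons, List.pairwise_cons] at hpw
    refine ⟨isSyntMultilinear_wexprIn hes u, isSyntMultilinear_prodWExpr h hes _ hpw.2, ?_⟩
    rw [varSet_wexprIn h, varSet_prodWExpr h]
    -- `X_u` is disjoint from the union of the other operands' variable sets
    have key : ∀ L : List (Finset σ), (∀ S ∈ L, Disjoint (operandVarSet vs u) S) →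
        Disjoint (operandVarSet vs u) (L.foldr (· ∪ ·) ∅) := by
      intro L hL
      induction L with
      | nil => exact disjoint_empty_right _
      | cons S L ih =>
        rw [List.foldr_cons, Finset.disjoint_union_right]
        exact ⟨hL S List.mem_cons_self, ih fun S' hS' => hL S' (List.mem_cons_of_mem _ hS')⟩
    exact key _ hpw.1

/-- **A syntactically multilinear gate list unfolds to syntactically multilinear trees.** [cite: Raz2006, §2] -/
theorem isSyntMultilinear_gateWExprs (gs : List (Gate k σ))
    (hsm : ∀ (i : ℕ) (args : List (Operand k σ)), gs[i]? = some (.prod args) →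
      (args.map (operandVarSet (gateVarSets (gs.take i)))).Pairwise Disjoint) :
    ∀ e ∈ gateWExprs gs, IsSyntMultilinear e := by
  induction gs using List.reverseRecOn with
  | nil => intro e he; simp [gateWExprs] at he
  | append_singleton gs g ih =>
    have hpre : ∀ (i : ℕ) (args : List (Operand k σ)), gs[i]? = some (.prod args) →
        (args.map (operandVarSet (gateVarSets (gs.take i)))).Pairwise Disjoint := by
      intro i args hi
      have hlt : i < gs.length := (List.getElem?_eq_some_iff.1 hi).1
      have := hsm i args (by rw [List.getElem?_append_left hlt]; exact hi)
      rwa [List.take_append_of_le_length hlt.le] at this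
    have hes := ih hpre
    intro e he
    rw [gateWExprs_append_singleton, List.mem_append, List.mem_singleton] at he
    rcases he with he | rfl
    · exact hes e he
    · cases g with
      | sum args => exact isSyntMultilinear_sumWExpr hes args
      | prod args =>
        refine isSyntMultilinear_prodWExpr (map_varSet_gateWExprs gs) hes args ?_
        have := hsm gs.length args (by simp)
        rwa [List.take_left'] at this
        rfl

/-- **The unfolding of a syntactically multilinear circuit is a syntactically multilinear tree.**
[cite: Raz2006, §2] -/
theorem isSyntMultilinear_toWExpr {P : ArithCircuit k σ} (h : IsSyntacticallyMultilinear P) :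
    IsSyntMultilinear P.toWExpr :=
  isSyntMultilinear_wexprIn (isSyntMultilinear_gateWExprs P.gates h) P.output

/-! ### Raz's theorem in the circuit vocabulary -/

/-- **Raz 2006, Cor. 3.6 (polynomial form), for fan-in-two syntactically multilinear formulas of
the tree's circuit model**: for every `b` there is `n₀` such that for all `u ≥ n₀`, no fan-in-two
syntactically multilinear formula (`IsFormula`, `IsSyntacticallyMultilinear`) with `≤ u^b` gates
over `2u` variables computes a full-rank polynomial. [cite: Raz2006, Cor. 3.6] -/
theorem not_isFullRank_of_syntMultilinear_formula {K : Type u} [Field K] (b : ℕ) :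
    ∃ n₀ : ℕ, ∀ u : ℕ, n₀ ≤ u → ∀ (P : ArithCircuit K (Fin (2 * u))) (g : MvPolynomial (Fin (2 * u)) K),
      P.IsFormula → P.IsFanInTwo → IsSyntacticallyMultilinear P → P.Computes g → P.size ≤ u ^ b →
        ¬ IsFullRank u g := by
  obtain ⟨n₀, h⟩ := not_isFullRank_of_syntMultilinear (K := K) b
  refine ⟨n₀, fun u hu P g hf h2 hsm hPg hsize => ?_⟩
  have hev : P.toWExpr.eval = g := by rw [eval_toWExpr]; exact hPg
  rw [← hev]
  exact h u hu P.toWExpr (isSyntMultilinear_toWExpr hsm) ((size_toWExpr_le hf h2).trans hsize)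

end Literature.Barriers.ValiantsHypothesis.RazFormula
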